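import Summits.NavierStokesRegularity.NavierStokesRegularity.Theorems.StrainDoorsFixedDeltaAlignment
import HarnessLib

/-!
# Strain doors, PART M §M25 — the fixed-`δ` direction criterion for LERAY–HOPF solutions under the
# global Type-I bound (the setting of Barker–Prange 2020, Theorem 3, `ν = 1`)

ROUND 67 of the `ns-regularity-ideate` p1 line (helper lane of `stmt-NavierStokesRegularity-0056`, rung N0;
nothing here is a claim about Navier–Stokes regularity — Type-I singular points are excluded under a direction
hypothesis; nothing about Type II).

★★★★ `lerayHopf_typeI_not_singular_of_fixedDeltaAlignment`.  For every `M` and `R > 0` there is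
`δ₀ = δ₀(M,R) > 0` such that: if `(u,p)` is a classical solution of the unit-viscosity unforced Navier–Stokes
system on `ℝ³ × [0,T)` which is Leray–Hopf on `[0,T)` and obeys the global Type-I bound
`|u(t,x)| ≤ M/√(T − t)` on `(0,T)` — the hypotheses of the tree's transcription of Barker–Prange's Theorem 3
(`barkerPrange2020_alignment_concentrating_typeI`, minus the compact support of the datum) — and if at some
`x₀`, for some `ρ > 0` and some threshold `d`, the vorticity directions satisfy `|ξ(t,y) − ξ(t,x)| ≤ δ₀` for
all same-time pairs of the backward parabolic ball `Q((T,x₀), ρ)` with `|ω| > d` at both points and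
`|y − x| ≤ R√(T − t)`, then `(T, x₀)` is NOT a singular point.  Barker–Prange assume instead
`|ξ(x,t_n) − ξ(y,t_n)| ≤ η(|x − y|)` with a MODULUS `η` (continuous, `η(0) = 0`) along a sequence `t_n ↑ T`;
Giga–Miura (CA) a modulus at all times.  Here: a FIXED `δ₀`, all times of a backward ball (not a sequence —
that refinement is not claimed).

Proof: Barker–Prange §4 Step 1 as in the tree (`SereginSverak2002.isSuitableWeakSolutionInBall_vertex`, zoom
by `√T/2` to the unit ball, `𝐈 < ∞` on inner balls by `albrittonBarker2019_lemma_2_5_rate_holds`, continuity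
from the classical solution, the vertex stays singular under the zoom), then §M24's
`exists_pos_fixedDeltaAlignment_not_singular` on the zoomed pair in the ball of radius
`min (1/2) (ρ/(√T/2))`, the direction hypothesis being invariant under the parabolic zoom (thresholds scale,
directions do not).

References: Barker–Prange, arXiv:1906.08225, Thm 3 and §4 Step 1; Seregin–Šverák 2002/2009; Albritton–Barker,
J. Math. Fluid Mech. 21 (2019) Lemma 2.5; Giga–Miura, Comm. Math. Phys. 303 (2011) Thm 1.1.
-/

noncomputable section

-- the summit and its single problem share the name `NavierStokesRegularity` (D-0017 nested layout)
set_option linter.dupNamespace false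

open MeasureTheory Set Function Filter Metric Real InnerProductSpace
open _root_.Topology
open scoped ENNReal NNReal RealInnerProductSpace ContDiff
open Literature.Analysis Literature.Analysis.FluidPDE Literature.Analysis.FluidPDE.LocalTypeIBlowup

namespace Summit.NavierStokesRegularity.NavierStokesRegularity.Theorems.StrainDoors

/-- ★★★★ **THE FIXED-`δ` DIRECTION CRITERION FOR LERAY–HOPF SOLUTIONS UNDER THE GLOBAL TYPE-I BOUND**
(Barker–Prange's Theorem-3 setting with the modulus replaced by a fixed `δ₀(M,R)`, all times of a backward
ball).  See the module docstring.
[cite: BarkerPrange2020Alignment, Thm 3 and §4 Step 1 (arXiv:1906.08225 pp. 16–18); GigaMiura2011, Thm 1.1;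
AlbrittonBarker2019, Lemma 2.5; SereginSverak2009, Thm 2.8] -/
theorem lerayHopf_typeI_not_singular_of_fixedDeltaAlignment (M : ℝ) {R : ℝ} (hR : 0 < R) :
    ∃ δ₀ : ℝ, 0 < δ₀ ∧
      ∀ (T : ℝ) (u : ℝ → EuclideanSpace ℝ (Fin 3) → EuclideanSpace ℝ (Fin 3))
        (p : ℝ → EuclideanSpace ℝ (Fin 3) → ℝ), 0 < T →
        IsClassicalNSSolutionOn (Ico 0 T) 1 0 u p → IsLerayHopfOn T 1 0 (u 0) u →
        (∀ t ∈ Ioo 0 T, ∀ x : EuclideanSpace ℝ (Fin 3), ‖u t x‖ ≤ M / Real.sqrt (T - t)) →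
        ∀ (x₀ : EuclideanSpace ℝ (Fin 3)) (ρ d : ℝ), 0 < ρ →
          (∀ (t : ℝ) (x y : EuclideanSpace ℝ (Fin 3)),
            (t, x) ∈ parabolicCylinder ρ ((T, x₀) : ℝ × EuclideanSpace ℝ (Fin 3)) →
            (t, y) ∈ parabolicCylinder ρ ((T, x₀) : ℝ × EuclideanSpace ℝ (Fin 3)) →
            d < ‖curl (u t) x‖ → d < ‖curl (u t) y‖ → ‖y - x‖ ≤ R * Real.sqrt (T - t) →
              ‖vorticityDirection (curl (u t)) y - vorticityDirection (curl (u t)) x‖ ≤ δ₀) →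
          ¬ IsBackwardSingularPoint u (T, x₀) := by
  obtain ⟨δ₀, hδ₀, hN6⟩ := exists_pos_fixedDeltaAlignment_not_singular M hR
  refine ⟨δ₀, hδ₀, ?_⟩
  intro T u p hT hcl hLH hI x₀ ρu d hρu hcoh hsing
  -- ## Barker–Prange §4 Step 1 (as in the tree's `exists_zoomLimit_at_singular_along`)
  set ρ : ℝ := Real.sqrt T / 2 with hρdef
  have hρ : 0 < ρ := by rw [hρdef]; positivity
  have hρ2 : ρ ^ 2 = T / 4 := by
    rw [hρdef, div_pow, Real.sq_sqrt hT.le]; norm_num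
  have hρT : ρ ^ 2 ≤ T := by rw [hρ2]; linarith
  set pg : ℝ → (EuclideanSpace ℝ (Fin 3)) → ℝ := fun t x => p t x - (p t 0 - normalisedPressure (u t) 0) with hpg
  have hballρ : IsSuitableWeakSolutionInBall ρ ((T, x₀) : ℝ × (EuclideanSpace ℝ (Fin 3))) u pg :=
    SereginSverak2002.isSuitableWeakSolutionInBall_vertex hT hcl hLH x₀ hρT
  set ut : ℝ → (EuclideanSpace ℝ (Fin 3)) → (EuclideanSpace ℝ (Fin 3)) := ρ • stPull (ρ ^ 2) ρ T x₀ u with hut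
  set pt : ℝ → (EuclideanSpace ℝ (Fin 3)) → ℝ := ρ ^ 2 • stPull (ρ ^ 2) ρ T x₀ pg with hpt
  have hball1 : IsSuitableWeakSolutionInBall 1 (0 : ℝ × (EuclideanSpace ℝ (Fin 3))) ut pt := by
    have h := hballρ.zoom hρ
    simpa only using h
  obtain ⟨G₁, hG₁, -⟩ := hball1.2.2.1
  have hrate1 : ∀ t' x', (t', x') ∈ parabolicCylinder 1 (0 : ℝ × (EuclideanSpace ℝ (Fin 3))) →
      ‖ut t' x'‖ ≤ M / Real.sqrt ((0 : ℝ × (EuclideanSpace ℝ (Fin 3))).1 - t') := by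
    intro t' x' hmem
    rw [mem_parabolicCylinder] at hmem
    simp only [Prod.fst_zero, Prod.snd_zero, zero_sub, one_pow, dist_zero_right] at hmem
    obtain ⟨⟨ht1, ht0⟩, -⟩ := hmem
    have ht' : 0 < -t' := by linarith
    have hτ : T + ρ ^ 2 * t' ∈ Ioo 0 T := by
      rw [hρ2]
      constructor <;> nlinarith
    have h := hI _ hτ (x₀ + ρ • x')
    have hsq : Real.sqrt (T - (T + ρ ^ 2 * t')) = ρ * Real.sqrt (-t') := by
      rw [show T - (T + ρ ^ 2 * t') = ρ ^ 2 * (-t') by ring, Real.sqrt_mul (sq_nonneg _), Real.sqrt_sq hρ.le]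
    rw [hsq] at h
    have hspos : 0 < Real.sqrt (-t') := Real.sqrt_pos.2 ht'
    simp only [Prod.fst_zero, zero_sub]
    show ‖(ρ • stPull (ρ ^ 2) ρ T x₀ u) t' x'‖ ≤ M / Real.sqrt (-t')
    rw [smul_stPull_apply, norm_smul, Real.norm_of_nonneg hρ.le, le_div_iff₀ hspos]
    have h' := (le_div_iff₀ (mul_pos hρ hspos)).1 h
    calc ρ * ‖u (T + ρ ^ 2 * t') (x₀ + ρ • x')‖ * Real.sqrt (-t')
        = ‖u (T + ρ ^ 2 * t') (x₀ + ρ • x')‖ * (ρ * Real.sqrt (-t')) := by ring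
      _ ≤ M := h'
  -- the inner radius `ρ' = min (1/2) (ρu/ρ)`
  set ρ' : ℝ := min (1 / 2) (ρu / ρ) with hρ'def
  have hρ' : 0 < ρ' := lt_min (by norm_num) (div_pos hρu hρ)
  have hρ'h : ρ' ≤ 1 / 2 := min_le_left _ _
  have hρ'1 : ρ' < 1 := by linarith
  have hρ'u : ρ * ρ' ≤ ρu := by
    have h1 : ρ' ≤ ρu / ρ := min_le_right _ _
    calc ρ * ρ' ≤ ρ * (ρu / ρ) := mul_le_mul_of_nonneg_left h1 hρ.le
      _ = ρu := by field_simp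
  have hI' : typeIBound (parabolicCylinder ρ' (0 : ℝ × (EuclideanSpace ℝ (Fin 3)))) ut pt G₁ < ⊤ :=
    albrittonBarker2019_lemma_2_5_rate_holds 0 ut pt M hball1 hrate1 G₁ hG₁ ρ' hρ' hρ'1
  have hball' : IsSuitableWeakSolutionInBall ρ' (0 : ℝ × (EuclideanSpace ℝ (Fin 3))) ut pt :=
    SuitableCompactness.isSuitableWeakSolutionInBall_of_le_radius hball1 hρ' hρ'1.le
  have hle : parabolicCylinderOpens ρ' (0 : ℝ × (EuclideanSpace ℝ (Fin 3))) ≤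
      parabolicCylinderOpens 1 (0 : ℝ × (EuclideanSpace ℝ (Fin 3))) :=
    parabolicCylinder_mono hρ'.le hρ'1.le _
  have hwg' : HasWeakSpatialGradientOn (parabolicCylinderOpens ρ' (0 : ℝ × (EuclideanSpace ℝ (Fin 3)))) ut G₁ :=
    hG₁.mono hle
  have hrate' : ∀ (t' : ℝ) (x' : EuclideanSpace ℝ (Fin 3)),
      (t', x') ∈ parabolicCylinder ρ' (0 : ℝ × (EuclideanSpace ℝ (Fin 3))) →
        ‖ut t' x'‖ ≤ M / Real.sqrt ((0 : ℝ × (EuclideanSpace ℝ (Fin 3))).1 - t') :=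
    fun t' x' h => hrate1 t' x' (hle h)
  -- continuity of the zoom on the inner ball (the classical solution is smooth on `[0, T) × ℝ³`)
  have hmaps : MapsTo (stAffine (ρ ^ 2) ρ T x₀)
      (parabolicCylinder ρ' (0 : ℝ × (EuclideanSpace ℝ (Fin 3)))) (Ico 0 T ×ˢ univ) := by
    rintro ⟨t', x'⟩ hmem
    rw [mem_parabolicCylinder] at hmem
    simp only [Prod.fst_zero, Prod.snd_zero, zero_sub, dist_zero_right] at hmem
    obtain ⟨⟨ht1, ht0⟩, -⟩ := hmem
    rw [stAffine_apply]
    have hρ'2 : ρ' ^ 2 ≤ 1 := by nlinarith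
    refine ⟨⟨?_, ?_⟩, mem_univ _⟩
    · rw [hρ2]; nlinarith
    · rw [hρ2]; nlinarith
  have hcont' : ContinuousOn (uncurry ut) (parabolicCylinder ρ' (0 : ℝ × (EuclideanSpace ℝ (Fin 3)))) := by
    have e : uncurry ut = fun w => ρ • (uncurry u ∘ stAffine (ρ ^ 2) ρ T x₀) w := by
      funext w
      rfl
    rw [e]
    exact ContinuousOn.const_smul
      (hcl.smooth_velocity.continuousOn.comp (continuous_stAffine _ _ _ _).continuousOn hmaps) ρ
  -- the vertex stays singular
  have hst1 : stAffine (ρ ^ 2) ρ T x₀ (0 : ℝ × (EuclideanSpace ℝ (Fin 3))) =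
      ((T, x₀) : ℝ × (EuclideanSpace ℝ (Fin 3))) := by
    rw [show (0 : ℝ × (EuclideanSpace ℝ (Fin 3))) = ((0 : ℝ), (0 : EuclideanSpace ℝ (Fin 3))) from rfl,
      stAffine_apply, mul_zero, add_zero, smul_zero, add_zero]
  have hsing1 : IsBackwardSingularPoint ut 0 := by
    intro r hr
    rw [hut, eLpNorm_top_nsZoom hρ T x₀ r 0 u, hst1, hsing (ρ * r) (mul_pos hρ hr),
      ENNReal.mul_top (ENNReal.ofReal_pos.2 hρ).ne']
  -- ## the direction hypothesis is invariant under the zoom (threshold `ρ² d`)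
  have hcurlut : ∀ t' x', curl (ut t') x' = (ρ * ρ) • curl (u (T + ρ ^ 2 * t')) (x₀ + ρ • x') := by
    intro t' x'
    rw [hut, curl_smul_stPull]
  have hmem_u : ∀ t' x', (t', x') ∈ parabolicCylinder ρ' (0 : ℝ × (EuclideanSpace ℝ (Fin 3))) →
      (T + ρ ^ 2 * t', x₀ + ρ • x') ∈ parabolicCylinder ρu ((T, x₀) : ℝ × EuclideanSpace ℝ (Fin 3)) := by
    intro t' x' hmem
    rw [mem_parabolicCylinder] at hmem ⊢
    simp only [Prod.fst_zero, Prod.snd_zero, zero_sub, dist_zero_right] at hmem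
    obtain ⟨⟨ht1, ht0⟩, hx⟩ := hmem
    refine ⟨⟨?_, by nlinarith [pow_pos hρ 2]⟩, ?_⟩
    · have h1 : ρ ^ 2 * (-t') < ρu ^ 2 := by
        calc ρ ^ 2 * (-t') < ρ ^ 2 * ρ' ^ 2 := by
              exact mul_lt_mul_of_pos_left (by nlinarith) (pow_pos hρ 2)
          _ = (ρ * ρ') ^ 2 := by ring
          _ ≤ ρu ^ 2 := pow_le_pow_left₀ (by positivity) hρ'u 2
      linarith
    · rw [dist_eq_norm, add_sub_cancel_left, norm_smul, Real.norm_of_nonneg hρ.le]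
      calc ρ * ‖x'‖ < ρ * ρ' := mul_lt_mul_of_pos_left hx hρ
        _ ≤ ρu := hρ'u
  have hcoh' : ∀ (t' : ℝ) (x' y' : EuclideanSpace ℝ (Fin 3)),
      (t', x') ∈ parabolicCylinder ρ' (0 : ℝ × (EuclideanSpace ℝ (Fin 3))) →
      (t', y') ∈ parabolicCylinder ρ' (0 : ℝ × (EuclideanSpace ℝ (Fin 3))) →
      ρ ^ 2 * d < ‖curl (ut t') x'‖ → ρ ^ 2 * d < ‖curl (ut t') y'‖ →
      ‖y' - x'‖ ≤ R * Real.sqrt ((0 : ℝ × (EuclideanSpace ℝ (Fin 3))).1 - t') →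
        ‖vorticityDirection (curl (ut t')) y' - vorticityDirection (curl (ut t')) x'‖ ≤ δ₀ := by
    intro t' x' y' hx' hy' hdx hdy hdist
    have ht0 : t' < 0 := by
      have h := hx'
      rw [mem_parabolicCylinder] at h
      simpa using h.1.2
    have hρρ : 0 < ρ * ρ := mul_pos hρ hρ
    -- LANDING NOTE (ns-s30-p1 g6): the text's helper `inv_norm_smul_smul_of_pos₆₇` restates landed lemmas in BOTH its
    -- forms (ℝ³: a ClockStretchingLaw module; general normed space: `Literature.AlgebraicTopology.SingularHomology.
    -- inv_norm_smul_smul`) — gate `dedup.landed` (p716755) — and importing either module into the NS lane for three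
    -- lines is not worth the dependency, so the computation is a local `have`; statements byte-identical.
    have hinv₆₇ : ∀ {c : ℝ}, 0 < c → ∀ v : EuclideanSpace ℝ (Fin 3), ‖c • v‖⁻¹ • (c • v) = ‖v‖⁻¹ • v :=
      fun {c} hc v => by
        by_cases hv : v = 0
        · simp [hv]
        · rw [norm_smul, Real.norm_eq_abs, abs_of_pos hc, mul_inv, smul_smul, mul_comm c⁻¹, mul_assoc,
            inv_mul_cancel₀ hc.ne', mul_one]
    rw [vorticityDirection_apply, vorticityDirection_apply, hcurlut, hcurlut,
      hinv₆₇ hρρ, hinv₆₇ hρρ, ← vorticityDirection_apply,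
      ← vorticityDirection_apply]
    rw [hcurlut, norm_smul, Real.norm_of_nonneg hρρ.le, ← pow_two] at hdx hdy
    have hdx' : d < ‖curl (u (T + ρ ^ 2 * t')) (x₀ + ρ • x')‖ := lt_of_mul_lt_mul_left hdx (sq_nonneg ρ)
    have hdy' : d < ‖curl (u (T + ρ ^ 2 * t')) (x₀ + ρ • y')‖ := lt_of_mul_lt_mul_left hdy (sq_nonneg ρ)
    refine hcoh _ _ _ (hmem_u t' x' hx') (hmem_u t' y' hy') hdx' hdy' ?_
    rw [add_sub_add_left_eq_sub, ← smul_sub, norm_smul, Real.norm_of_nonneg hρ.le]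
    have hsq : Real.sqrt (T - (T + ρ ^ 2 * t')) = ρ * Real.sqrt (-t') := by
      rw [show T - (T + ρ ^ 2 * t') = ρ ^ 2 * (-t') by ring, Real.sqrt_mul (sq_nonneg _), Real.sqrt_sq hρ.le]
    rw [hsq]
    simp only [Prod.fst_zero, zero_sub] at hdist
    calc ρ * ‖y' - x'‖ ≤ ρ * (R * Real.sqrt (-t')) := mul_le_mul_of_nonneg_left hdist hρ.le
      _ = R * (ρ * Real.sqrt (-t')) := by ring
  -- ## §M24 on the zoomed pair
  exact hN6 ut pt G₁ 0 ρ' (ρ ^ 2 * d) hρ' hball' hwg' hI' hcont' hrate' hcoh' hsing1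

end Summit.NavierStokesRegularity.NavierStokesRegularity.Theorems.StrainDoors

end
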